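/-
Copyright (c) 2026. All rights reserved.
Released under Apache 2.0 license as described in the file LICENSE.
Authors: abc-iut cell, campaign-S prover seat abc-iut-S7.
-/
import Literature.IUT.LogVolume.PadicModuleTopology
import Literature.IUT.LogVolume.LocalFieldVolume
import Literature.IUT.LogVolume.HaarTransport
import Literature.IUT.LogVolume.ProductVolume
import HarnessLib

/-!
# Volumes of box lattices in a finite-dimensional `ℚ_p`-vector space: `μ_{L_b}(∏ c_i ℤ_p b_i) = ∏ ‖c_i‖`

Classical Haar-measure bookkeeping behind the "log-volumes on tensor products" of [IUTchIV] Prop. 1.4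
(kurims p. 13) and Dupuy–Hilado §3.4 (`log μ̄_W := log μ_W / dim W`): in a finite-dimensional
`ℚ_p`-vector space `W` with the module topology (`PadicModuleTopology.lean`) and a basis `b`, the Haar
measure normalised on the lattice `L_b = ⊕ ℤ_p b_i` is, in coordinates, the PRODUCT of the Haar measures
of `ℚ_p` normalised on `ℤ_p` (uniqueness of Haar measure; `HaarTransport.map_haar_eq_haar` +
`ProductVolume.pi_haar_eq`), so the **box lattice** `boxLattice b c = {w | ‖w_i‖ ≤ ‖c_i‖} = ⊕ c_i ℤ_p b_i`
(`c_i ∈ ℚ_p^×`) has volume `∏_i ‖c_i‖` (`haar_boxLattice`) and log-volume `Σ_i log ‖c_i‖`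
(`logVolume_boxLattice`).  Ingredient on `ℚ_p` itself: the Haar modulus of `c ∈ ℚ_p^×` is `‖c‖`
(`distribHaarChar_padic_eq_nnnorm`, Weil, *Basic Number Theory* I §2), so `μ(c·ℤ_p) = ‖c‖`.
Used by `TensorPacketLattice.lean` (Smith-normal-form bases turn `⊗_i M_i` into a box lattice).
[cite: WeilBNT1967, Ch. I §2, Cor. 2 of Th. 3] [cite: Mochizuki2012, IUTchIV Prop. 1.4 (i) p. 13]
Deliberately NOT here: tensor products; anything disputed.
-/

noncomputable section

open MeasureTheory MeasureTheory.Measure Set Metric TopologicalSpace Module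
open scoped NNReal ENNReal Pointwise
open Literature.NumberTheory.GaloisRepresentations.Ultrametric
open Literature.NumberTheory.GaloisRepresentations.Ultrametric.PadicUniformizer

namespace Literature.IUT.LogVolume

/-! ### The Haar modulus on `ℚ_p` is the norm -/

section Padic

variable (p : ℕ) [Fact p.Prime]

/-- `mod(c⁻¹) = mod(c)⁻¹` on `ℚ_p^×`. [cite: WeilBNT1967, Ch. I §2, Cor. 2 of Th. 3] -/
theorem distribHaarChar_padic_inv (c : ℚ_[p]ˣ) :
    distribHaarChar ℚ_[p] c⁻¹ = (distribHaarChar ℚ_[p] c)⁻¹ :=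
  eq_inv_of_mul_eq_one_left (by rw [← map_mul, inv_mul_cancel, map_one])

/-- **`mod_{ℚ_p}(c) = ‖c‖`**: the Haar modulus of a nonzero `p`-adic number is its normalised absolute
value (`c = p^m·u`, `mod(p) = p⁻¹ = ‖p‖`, units have modulus `1`).
[cite: WeilBNT1967, Ch. I §4, Th. 6] -/
theorem distribHaarChar_padic_eq_nnnorm (c : ℚ_[p]ˣ) :
    distribHaarChar ℚ_[p] c = ‖(c : ℚ_[p])‖₊ := by
  obtain ⟨m, hm⟩ := (isUniformizer_varpi p).2 c
  obtain ⟨u, hu, rfl⟩ := exists_eq_zpow_mul_of_norm_eq _ c m hm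
  apply NNReal.coe_injective
  rw [map_mul, map_zpow' _ (distribHaarChar_padic_inv p), distribHaarChar_padic,
    distribHaarChar_eq_one_of_norm_eq_one u hu, mul_one, coe_nnnorm, Units.val_mul,
    Units.val_zpow_eq_zpow_val, norm_mul, norm_zpow, hu, mul_one, varpi_val, Padic.norm_p]
  push_cast
  rfl

/-- **`μ(c·ℤ_p) = ‖c‖`** for the Haar measure of `ℚ_p` normalised on `ℤ_p`.
[cite: WeilBNT1967, Ch. I §2, Cor. 2 of Th. 3] -/
theorem localVolume_padic_closedBall_norm [MeasurableSpace ℚ_[p]] [BorelSpace ℚ_[p]] (c : ℚ_[p]ˣ) :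
    localVolume ℚ_[p] (closedBall (0 : ℚ_[p]) ‖(c : ℚ_[p])‖) = ‖(c : ℚ_[p])‖₊ := by
  rw [← units_smul_unitBall c, localVolume_units_smul, localVolume_closedBall_one, mul_one,
    distribHaarChar_padic_eq_nnnorm]

end Padic

namespace PadicModule

variable (p : ℕ) [Fact p.Prime]
variable {W : Type*} [AddCommGroup W] [Module ℚ_[p] W]

include p

/-! ### Box lattices -/

/-- **Box lattice** of a basis `b` with radii `‖c_i‖`, `c_i ∈ ℚ_p^×`: the vectors whose `i`-th
`b`-coordinate has norm `≤ ‖c_i‖`, i.e. `⊕_i c_i ℤ_p b_i` (the `ℤ_p`-span of `c_i b_i`; a Smith normal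
form presents every full sublattice of `L_b` this way). [cite: WeilBNT1967, Ch. II §2, Th. 1] -/
def boxLattice {ι : Type*} [Fintype ι] (b : Module.Basis ι ℚ_[p] W) (c : ι → ℚ_[p]ˣ) : AddSubgroup W :=
  (AddSubgroup.pi Set.univ fun i : ι => ((piBall (c i) : OpenAddSubgroup ℚ_[p]) : AddSubgroup ℚ_[p])).comap
    b.equivFun.toLinearMap.toAddMonoidHom

/-- Membership in a box lattice. [cite: WeilBNT1967, Ch. II §2, Th. 1] -/
theorem mem_boxLattice {ι : Type*} [Fintype ι] (b : Module.Basis ι ℚ_[p] W) (c : ι → ℚ_[p]ˣ) {w : W} :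
    w ∈ boxLattice p b c ↔ ∀ i, ‖b.repr w i‖ ≤ ‖(c i : ℚ_[p])‖ := by
  simp [boxLattice, AddSubgroup.mem_pi, mem_piBall]

/-- The box lattice with all radii `1` is the lattice of the basis. [cite: WeilBNT1967, Ch. II §2, Th. 1] -/
theorem boxLattice_one {ι : Type*} [Fintype ι] (b : Module.Basis ι ℚ_[p] W) :
    boxLattice p b 1 = basisLattice p b := by
  ext w
  simp [mem_boxLattice, mem_basisLattice]

/-- Box lattices are `ℤ_p`-stable. [cite: WeilBNT1967, Ch. II §2, Th. 1] -/
theorem smul_mem_boxLattice {ι : Type*} [Fintype ι] (b : Module.Basis ι ℚ_[p] W) (c : ι → ℚ_[p]ˣ)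
    {s : ℚ_[p]} (hs : ‖s‖ ≤ 1) {w : W} (hw : w ∈ boxLattice p b c) : s • w ∈ boxLattice p b c := by
  rw [mem_boxLattice] at hw ⊢
  intro i
  rw [map_smul, Finsupp.smul_apply, smul_eq_mul, norm_mul]
  calc ‖s‖ * ‖b.repr w i‖ ≤ 1 * ‖(c i : ℚ_[p])‖ :=
        mul_le_mul hs (hw i) (norm_nonneg _) zero_le_one
    _ = ‖(c i : ℚ_[p])‖ := one_mul _

/-- `c_i • b_i` lies in the box lattice. [cite: WeilBNT1967, Ch. II §2, Th. 1] -/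
theorem smul_basis_mem_boxLattice {ι : Type*} [Fintype ι] [DecidableEq ι] (b : Module.Basis ι ℚ_[p] W)
    (c : ι → ℚ_[p]ˣ) (i : ι) : (c i : ℚ_[p]) • b i ∈ boxLattice p b c := by
  rw [mem_boxLattice]
  intro j
  rw [map_smul, Finsupp.smul_apply, b.repr_self, Finsupp.single_apply]
  split_ifs with h
  · subst h; simp
  · simp

variable [TopologicalSpace W] [IsModuleTopology ℚ_[p] W]

/-- A box lattice is the preimage of a box of balls under the coordinate isomorphism.
[cite: WeilBNT1967, Ch. II §2, Th. 1] -/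
theorem coe_boxLattice {ι : Type*} [Fintype ι] (b : Module.Basis ι ℚ_[p] W) (c : ι → ℚ_[p]ˣ) :
    (boxLattice p b c : Set W) =
      basisContinuousAddEquiv p W b ⁻¹' Set.pi Set.univ (fun i => closedBall (0 : ℚ_[p]) ‖(c i : ℚ_[p])‖) := by
  ext w
  simp [mem_boxLattice, Set.mem_pi]

/-- The coordinate isomorphism carries the lattice of the basis ONTO the unit box `ℤ_p^ι`.
[cite: WeilBNT1967, Ch. II §2, Th. 1] -/
theorem image_basisLattice {ι : Type*} [Fintype ι] (b : Module.Basis ι ℚ_[p] W) :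
    basisContinuousAddEquiv p W b '' (basisLattice p b : Set W) =
      Set.pi Set.univ (fun _ : ι => closedBall (0 : ℚ_[p]) 1) := by
  rw [coe_basisLattice, Set.image_preimage_eq _ (basisContinuousAddEquiv p W b).surjective]

variable [IsTopologicalAddGroup W] [MeasurableSpace W] [BorelSpace W]

/-- **Haar measure in coordinates**: for every box of sets, `μ_{L_b}(b-coordinates ∈ ∏ A_i) =
∏_i μ_{ℚ_p}(A_i)` with `μ_{ℚ_p}(ℤ_p) = 1` — the Haar measure normalised on the lattice of a basis is the
product measure in that basis (transport + uniqueness). [cite: WeilBNT1967, Ch. II §2, Th. 1] -/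
theorem haar_preimage_pi {ι : Type*} [Fintype ι] (b : Module.Basis ι ℚ_[p] W) (A : ι → Set ℚ_[p])
    [MeasurableSpace ℚ_[p]] [BorelSpace ℚ_[p]] :
    (basisIntegralStructure p b).haar (basisContinuousAddEquiv p W b ⁻¹' Set.pi Set.univ A) =
      ∏ i, localVolume ℚ_[p] (A i) := by
  have hφ : basisContinuousAddEquiv p W b '' (basisIntegralStructure p b : Set W) =
      (IntegralStructure.pi (fun _ : ι => unitBallStructure ℚ_[p]) : Set (ι → ℚ_[p])) := by
    rw [coe_basisIntegralStructure, image_basisLattice, IntegralStructure.coe_pi]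
    rfl
  rw [(basisIntegralStructure p b).haar_preimage_equiv _ _ hφ, IntegralStructure.pi_haar_pi]
  rfl

/-- **Volume of a box lattice**: `μ_{L_b}(⊕ c_i ℤ_p b_i) = ∏_i ‖c_i‖`.
[cite: WeilBNT1967, Ch. II §2, Th. 1] -/
theorem haar_boxLattice {ι : Type*} [Fintype ι] (b : Module.Basis ι ℚ_[p] W) (c : ι → ℚ_[p]ˣ) :
    (basisIntegralStructure p b).haar (boxLattice p b c) = ∏ i, (‖(c i : ℚ_[p])‖₊ : ℝ≥0∞) := by
  borelize ℚ_[p]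
  rw [coe_boxLattice, haar_preimage_pi]
  exact Finset.prod_congr rfl fun i _ => localVolume_padic_closedBall_norm p (c i)

/-- The volume of a box lattice is positive and finite (as a real number, `∏ ‖c_i‖`).
[cite: WeilBNT1967, Ch. II §2, Th. 1] -/
theorem haar_real_boxLattice {ι : Type*} [Fintype ι] (b : Module.Basis ι ℚ_[p] W) (c : ι → ℚ_[p]ˣ) :
    ((basisIntegralStructure p b).haar (boxLattice p b c)).toReal = ∏ i, ‖(c i : ℚ_[p])‖ := by
  rw [haar_boxLattice, ENNReal.toReal_prod]
  exact Finset.prod_congr rfl fun i _ => by simp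

/-- **Log-volume of a box lattice**: `μ^log_{L_b}(⊕ c_i ℤ_p b_i) = Σ_i log ‖c_i‖`.
[cite: WeilBNT1967, Ch. II §2, Th. 1] -/
theorem logVolume_boxLattice {ι : Type*} [Fintype ι] (b : Module.Basis ι ℚ_[p] W) (c : ι → ℚ_[p]ˣ) :
    (basisIntegralStructure p b).logVolume (boxLattice p b c) = ∑ i, Real.log ‖(c i : ℚ_[p])‖ := by
  rw [IntegralStructure.logVolume, haar_real_boxLattice,
    Real.log_prod fun i _ => norm_ne_zero_iff.mpr (c i).ne_zero]

end PadicModule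

end Literature.IUT.LogVolume

end
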